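import Summits.QuantumFields.YangMills.Theorems.BalabanLadderUVSeamRecClassicalResponseDefs
import Summits.QuantumFields.YangMills.Theorems.BalabanLadderUVSeamRecCeilingsSubGaussianCarrierUnit
import Summits.QuantumFields.YangMills.Theorems.BalabanLadderUVSeamRecPolymerCarrier
import Summits.QuantumFields.YangMills.Theorems.BalabanLadderUVSeamRecResponseMomentsDefs
import HarnessLib

/-!
# Crux `UVSeamRec` (stmt-QuantumFields-20043): the v6(β-cl) GLUE — «background field» ⊕ «Gaussian domination» ⇒ `ResponseMomentsOdd6SU2`

Helper file (`--supports stmt-QuantumFields-20043`) of the LEAD seat `ym-spine-20043-p1` (gen 8); the glue (i)–(v) of the LEAD's line card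
(evidence #60 on the item, `FINDING-20043-g8-subgaussian-carrier.md` §6) typed over landed pieces: p546887 (`ClassicalResponse.carrierCl`),
p545723 (`TemperedResponse.emQ_of_subGaussianLinear`), p541348 (`PolymerData.responseMoments_of_quadratic_and_influence`), p536324
(`ResponseMomentsDefs.ResponseMomentsOdd6SU2` = the registered v5(α) stub body, named).

The two would-be stubs of a by-name v6(β-cl) of `BirthV5A.stub_responseMomentsOdd6` (NOT registered; the owner's pen):
* (BF) «background field» — tempering data `𝔟 ε kmax`, constants `C_s C₁ A₀ P₀ β₁ ℓ₁ B_I`, reference values `p`, such that (split-cl)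
  `(R⁴/C₁)|kerE(plane q x)(η) − p q β| ≤ A₀ + carrierCl rF C_s 1 β R q x η + influenceAt 𝔟 ε kmax β R q x η` for all exteriors at the unit of record
  (`R·uRec β ≤ ℓ₁`), AND (EM_I) the doubled joint exponential moments of the influence functional (p541348's `hEMI`) — ONE package because
  (split) and (EM_I) share the tempering data;
* (GD) «Gaussian domination» — constants `m₁ v₁ β₁' ℓ₁'` such that the extensive sub-Gaussian LINEAR-source law (EM_lin) holds for
  `ℓ := √(carrierCl rF 1 1 β R q x ·)` (carrier constant `C = 1`, NO smallness on `v₁`).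
GLUE: `split_rescale` (enlarging the carrier constant `C_s ↦ C` costs `C₁ ↦ C₁·C/C_s`), `sqrt_carrierCl_eq_div` + `emLin_rescale`
(`√(carrierCl C) = √(carrierCl 1)/√C`, so (m₁, v₁) ↦ (m₁/√C, v₁/C)), the choice `C := max C_s (4v₁ + 1)`, p545723 for (EM_Q), p541348 for (RM),
`a := uRec`, `c := 1`.  Main theorem: `responseMomentsOdd6SU2_of_backgroundField_and_gaussianDomination : (BF) → (GD) → ResponseMomentsOdd6SU2`.
HONEST FRAMING: composition only; (BF) is E0′-K with background in Bałaban's own currency and (GD) is Gaussian domination of one gauge-invariant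
classical statistic under the Wilson state — both OPEN; nothing of E0′; not a gap, not Clay.
-/

set_option autoImplicit false

noncomputable section

open MeasureTheory Filter Topology Finset
open Literature.MathematicalPhysics.QuantumFieldTheory (GaugeConfig LatticeRep)
open Literature.MathematicalPhysics.QuantumLattice
open Summit.QuantumFields.YangMills.Cruxes.OSLegsFromFemtoAndGap.DlrCollarTransfer
open Summit.QuantumFields.YangMills.Cruxes.UVSeamRec.ClassicalResponse
open Summit.QuantumFields.YangMills.Cruxes.UVSeamRec.PolymerData
open Summit.QuantumFields.YangMills.Cruxes.UVSeamRec.TemperedResponse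

namespace Summit.QuantumFields.YangMills.Cruxes.UVSeamRec.ClassicalResponse

/-! ## §1 Rescaling the carrier constant -/

section Rescale

variable {G : Type} [Group G] [TopologicalSpace G] [IsTopologicalGroup G] [CompactSpace G]
  [MeasurableSpace G] [BorelSpace G] (r : LatticeRep G)

omit [IsTopologicalGroup G] [CompactSpace G] [BorelSpace G] in
/-- `carrierCl C' = (C/C') · carrierCl C` (the carrier is inversely proportional to its constant). [folklore] -/
theorem carrierCl_eq_mul (C C' s β : ℝ) (hC : C ≠ 0) (R : ℕ) (q : Fin 4 × Fin 4) (x : Fin 4 → ℤ) (η : LGConfig 4 G) :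
    carrierCl r C' s β R q x η = C / C' * carrierCl r C s β R q x η := by
  unfold carrierCl
  field_simp

omit [IsTopologicalGroup G] [CompactSpace G] [BorelSpace G] in
/-- `√(carrierCl C) = √(carrierCl 1) / √C` for `C > 0`. [folklore] -/
theorem sqrt_carrierCl_eq_div {C : ℝ} (hC : 0 < C) (s β : ℝ) (R : ℕ) (q : Fin 4 × Fin 4) (x : Fin 4 → ℤ) (η : LGConfig 4 G) :
    Real.sqrt (carrierCl r C s β R q x η) = Real.sqrt (carrierCl r 1 s β R q x η) / Real.sqrt C := by
  rw [carrierCl_eq_mul r 1 C s β one_ne_zero, one_div, ← div_eq_inv_mul, Real.sqrt_div' _ hC.le]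

end Rescale

/-! ## §2 The glue at `SU(2)`, fundamental representation, unit of record -/

section Glue

/-- Shorthand-free statement of (split-cl) at carrier constant `C`, kernel constant `C₁`, unit of record. -/
def SplitCl (𝔟 : BlockSize) (ε : ℝ → ℕ → ℝ) (kmax : ℝ → ℕ → ℕ) (C C₁ A₀ β₁ ℓ₁ : ℝ) (p : Fin 4 × Fin 4 → ℝ → ℝ) : Prop :=
  ∀ β : ℝ, β₁ ≤ β → ∀ R : ℕ, 1 ≤ R → (R : ℝ) * Transport.uRec β ≤ ℓ₁ →
    ∀ (q : Fin 4 × Fin 4) (x : Fin 4 → ℤ), q.1 < q.2 → ∀ η : LGConfig 4 (Matrix.specialUnitaryGroup (Fin 2) ℂ),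
      (R : ℝ) ^ 4 / C₁ * |kerE (Matrix.specialUnitaryGroup (Fin 2) ℂ) (fundamentalLatticeRep 2) β (fun k => x k - (R + 1)) (2 * R + 3) η
        (plane (Matrix.specialUnitaryGroup (Fin 2) ℂ) (fundamentalLatticeRep 2) q x) - p q β| ≤
        A₀ + carrierCl (fundamentalLatticeRep 2) C 1 β R q x η + influenceAt (N := 2) 𝔟 ε kmax β R q x η

/-- (EM_I) at the unit of record: doubled joint exponential moments of the influence functional (p541348's `hEMI`). -/
def EMI (𝔟 : BlockSize) (ε : ℝ → ℕ → ℝ) (kmax : ℝ → ℕ → ℕ) (β₁ ℓ₁ B_I : ℝ) : Prop :=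
  ∀ β : ℝ, β₁ ≤ β → ∀ (L n : ℕ) (q : Fin n → Fin 4 × Fin 4) (x : Fin n → (Fin 4 → ℤ)) (R : ℕ),
    (∀ i, (q i).1 < (q i).2) → 1 ≤ R → (R : ℝ) * Transport.uRec β ≤ ℓ₁ → 4 * R + 8 ≤ L →
    (∀ i j : Fin n, i ≠ j → ∃ k : Fin 4,
      (2 * (R : ℤ) + 4) ≤ |((((x i k - x j k : ℤ) : ZMod (2 * L + 1))).valMinAbs : ℤ)|) →
    ∀ T : Finset (Fin n),
      torusE (Matrix.specialUnitaryGroup (Fin 2) ℂ) (fundamentalLatticeRep 2) β L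
        (fun U => Real.exp (((2 : ℕ) : ℝ) * ∑ i ∈ T, influenceAt (N := 2) 𝔟 ε kmax β R (q i) (x i) U)) ≤ Real.exp (B_I * T.card)

/-- (EM_lin) at the unit of record for the square root of the classical carrier with constant `C`, constants `(m, v)`. -/
def EMLin (C β₁ ℓ₁ m v : ℝ) : Prop :=
  ∀ β : ℝ, β₁ ≤ β → ∀ (L n : ℕ) (q : Fin n → Fin 4 × Fin 4) (x : Fin n → (Fin 4 → ℤ)) (R : ℕ),
    (∀ i, (q i).1 < (q i).2) → 1 ≤ R → (R : ℝ) * Transport.uRec β ≤ ℓ₁ → 4 * R + 8 ≤ L →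
    (∀ i j : Fin n, i ≠ j → ∃ k : Fin 4,
      (2 * (R : ℤ) + 4) ≤ |((((x i k - x j k : ℤ) : ZMod (2 * L + 1))).valMinAbs : ℤ)|) →
    ∀ (T : Finset (Fin n)) (t : Fin n → ℝ),
      torusE (Matrix.specialUnitaryGroup (Fin 2) ℂ) (fundamentalLatticeRep 2) β L
        (fun U => Real.exp (∑ i ∈ T, t i * Real.sqrt (carrierCl (fundamentalLatticeRep 2) C 1 β R (q i) (x i) U))) ≤
        Real.exp (m * ∑ i ∈ T, |t i| + v / 2 * ∑ i ∈ T, (t i) ^ 2)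

/-- **(BF) «background field»** — the would-be first stub of v6(β-cl): tempering data and constants with (split-cl) ∧ (EM_I). -/
def BackgroundFieldSU2 : Prop :=
  ∃ (𝔟 : BlockSize) (ε : ℝ → ℕ → ℝ) (kmax : ℝ → ℕ → ℕ) (C_s C₁ A₀ P₀ β₁ ℓ₁ B_I : ℝ) (p : Fin 4 × Fin 4 → ℝ → ℝ),
    0 < C_s ∧ 0 < C₁ ∧ 0 ≤ A₀ ∧ 0 < ℓ₁ ∧ (∀ q β, |p q β| ≤ P₀) ∧
    SplitCl 𝔟 ε kmax C_s C₁ A₀ β₁ ℓ₁ p ∧ EMI 𝔟 ε kmax β₁ ℓ₁ B_I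

/-- **(GD) «Gaussian domination»** — the would-be second stub of v6(β-cl): (EM_lin) for `√(carrierCl 1 1)` with SOME constants. -/
def GaussianDominationSU2 : Prop :=
  ∃ (m₁ v₁ β₁ ℓ₁ : ℝ), 0 < ℓ₁ ∧ EMLin 1 β₁ ℓ₁ m₁ v₁

/-- **Rescaling (split-cl)**: enlarging the carrier constant `C_s ↦ C ≥ C_s` keeps (split-cl) with `C₁ ↦ C₁·C/C_s` (uses `A₀ ≥ 0`,
`influenceAt ≥ 0`). [folklore] -/
theorem splitCl_rescale {𝔟 : BlockSize} {ε : ℝ → ℕ → ℝ} {kmax : ℝ → ℕ → ℕ} {C_s C C₁ A₀ β₁ ℓ₁ : ℝ} {p : Fin 4 × Fin 4 → ℝ → ℝ}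
    (hCs : 0 < C_s) (hC : C_s ≤ C) (hA₀ : 0 ≤ A₀) (h : SplitCl 𝔟 ε kmax C_s C₁ A₀ β₁ ℓ₁ p) :
    SplitCl 𝔟 ε kmax C (C₁ * C / C_s) A₀ β₁ ℓ₁ p := by
  intro β hβ R hR hRa q x hq η
  have h0 := h β hβ R hR hRa q x hq η
  have hCpos : 0 < C := hCs.trans_le hC
  have hI : 0 ≤ influenceAt (N := 2) 𝔟 ε kmax β R q x η := by
    rw [influenceAt_eq]; exact influence_nonneg (N := 2) 𝔟 (ε β) (kmax β R) R x η
  rw [carrierCl_eq_mul (fundamentalLatticeRep 2) C C_s 1 β hCpos.ne'] at h0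
  set Q := carrierCl (fundamentalLatticeRep 2) C 1 β R q x η with hQ
  set I := influenceAt (N := 2) 𝔟 ε kmax β R q x η with hI'
  set E := |kerE (Matrix.specialUnitaryGroup (Fin 2) ℂ) (fundamentalLatticeRep 2) β (fun k => x k - (R + 1)) (2 * R + 3) η
        (plane (Matrix.specialUnitaryGroup (Fin 2) ℂ) (fundamentalLatticeRep 2) q x) - p q β| with hE
  have hE0 : 0 ≤ E := abs_nonneg _
  have hratio : C_s / C ≤ 1 := (div_le_one hCpos).2 hC
  have hratio0 : 0 ≤ C_s / C := by positivity
  -- multiply the hypothesis by `C_s / C`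
  have h1 : (R : ℝ) ^ 4 / (C₁ * C / C_s) * E = C_s / C * ((R : ℝ) ^ 4 / C₁ * E) := by
    field_simp
  rw [h1]
  have h2 : C_s / C * ((R : ℝ) ^ 4 / C₁ * E) ≤ C_s / C * (A₀ + C / C_s * Q + I) :=
    mul_le_mul_of_nonneg_left h0 hratio0
  have h3 : C_s / C * (A₀ + C / C_s * Q + I) = C_s / C * A₀ + Q + C_s / C * I := by
    field_simp
  rw [h3] at h2
  have h4 : C_s / C * A₀ ≤ A₀ := mul_le_of_le_one_left hA₀ hratio
  have h5 : C_s / C * I ≤ I := mul_le_of_le_one_left hI hratio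
  linarith

/-- **Rescaling (EM_lin)**: `√(carrierCl C) = √(carrierCl 1)/√C`, so the law for `C = 1` with `(m, v)` gives the law for `C > 0` with
`(m/√C, v/C)` (substitute `t ↦ t/√C`). [folklore] -/
theorem emLin_rescale {C β₁ ℓ₁ m v : ℝ} (hC : 0 < C) (h : EMLin 1 β₁ ℓ₁ m v) :
    EMLin C β₁ ℓ₁ (m / Real.sqrt C) (v / C) := by
  intro β hβ L n q x R hq hR hRa hL hsep T t
  have hsC : 0 < Real.sqrt C := Real.sqrt_pos.2 hC
  have h0 := h β hβ L n q x R hq hR hRa hL hsep T (fun i => t i / Real.sqrt C)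
  have e1 : (fun U : LGConfig 4 (Matrix.specialUnitaryGroup (Fin 2) ℂ) =>
      Real.exp (∑ i ∈ T, t i * Real.sqrt (carrierCl (fundamentalLatticeRep 2) C 1 β R (q i) (x i) U))) =
      (fun U => Real.exp (∑ i ∈ T, t i / Real.sqrt C *
        Real.sqrt (carrierCl (fundamentalLatticeRep 2) 1 1 β R (q i) (x i) U))) := by
    funext U
    refine congrArg Real.exp (Finset.sum_congr rfl fun i _ => ?_)
    rw [sqrt_carrierCl_eq_div (fundamentalLatticeRep 2) hC]
    ring
  have e2 : m / Real.sqrt C * ∑ i ∈ T, |t i| + v / C / 2 * ∑ i ∈ T, t i ^ 2 =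
      m * ∑ i ∈ T, |t i / Real.sqrt C| + v / 2 * ∑ i ∈ T, (t i / Real.sqrt C) ^ 2 := by
    have hsq : Real.sqrt C ^ 2 = C := Real.sq_sqrt hC.le
    simp_rw [abs_div, abs_of_pos hsC, div_pow, hsq, ← Finset.sum_div]
    field_simp
  rw [e1, e2]
  exact h0

/-- **THE v6(β-cl) GLUE**: (BF) «background field» and (GD) «Gaussian domination» give the registered v5(α) stub body
`ResponseMomentsOdd6SU2` (hence `stub_ceilings` through `stubCeilings_of_responseMomentsOdd6SU2`).  Mechanism: `C := max C_s (4v₁ + 1)`;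
rescale (split-cl) and (EM_lin) to `C`; `β₁ := max (max β₁ β₁') 0`, `ℓ₁ := min ℓ₁ ℓ₁'`; (EM_Q) for `Q := carrierCl C 1 = 1·(√Q)²` by p545723
`emQ_of_subGaussianLinear`; (RM) body by p541348 `responseMoments_of_quadratic_and_influence`; unit `a := uRec`, `c := 1`. [folklore] -/
theorem responseMomentsOdd6SU2_of_backgroundField_and_gaussianDomination
    (hBF : BackgroundFieldSU2) (hGD : GaussianDominationSU2) : ResponseMomentsDefs.ResponseMomentsOdd6SU2 := by
  obtain ⟨𝔟, ε, kmax, C_s, C₁, A₀, P₀, β₁, ℓ₁, B_I, p, hCs, hC₁, hA₀, hℓ₁, hp, hsplit, hEMI⟩ := hBF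
  obtain ⟨m₁, v₁, β₁', ℓ₁', hℓ₁', hEM⟩ := hGD
  -- constants
  set C : ℝ := max C_s (4 * v₁ + 1) with hCdef
  have hCsC : C_s ≤ C := le_max_left _ _
  have hCpos : 0 < C := hCs.trans_le hCsC
  have h4v : 4 * (v₁ / C) < 1 := by
    rw [mul_div_assoc', div_lt_one hCpos]
    have : 4 * v₁ + 1 ≤ C := le_max_right _ _
    linarith
  set β₀ : ℝ := max (max β₁ β₁') 0 with hβ₀
  have hβ₀₁ : β₁ ≤ β₀ := (le_max_left _ _).trans (le_max_left _ _)
  have hβ₀₁' : β₁' ≤ β₀ := (le_max_right _ _).trans (le_max_left _ _)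
  have hβ₀0 : 0 ≤ β₀ := le_max_right _ _
  set ℓ₀ : ℝ := min ℓ₁ ℓ₁' with hℓ₀
  have hℓ₀pos : 0 < ℓ₀ := lt_min hℓ₁ hℓ₁'
  set rF : LatticeRep (Matrix.specialUnitaryGroup (Fin 2) ℂ) := fundamentalLatticeRep 2 with hrF
  -- rescaled laws
  have hsplitC := splitCl_rescale hCs hCsC hA₀ hsplit
  have hEMC := emLin_rescale hCpos hEM
  -- the quadratic carrier and its linear statistic
  set Q : ℝ → ℕ → Fin 4 × Fin 4 → (Fin 4 → ℤ) → LGConfig 4 (Matrix.specialUnitaryGroup (Fin 2) ℂ) → ℝ :=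
    fun β R q x η => carrierCl rF C 1 β R q x η with hQdef
  set ℓ : ℝ → ℕ → Fin 4 × Fin 4 → (Fin 4 → ℤ) → LGConfig 4 (Matrix.specialUnitaryGroup (Fin 2) ℂ) → ℝ :=
    fun β R q x η => Real.sqrt (carrierCl rF C 1 β R q x η) with hℓdef
  have hℓm : ∀ β R q x, Measurable (ℓ β R q x) := fun β R q x => (measurable_carrierCl (r := rF) C 1 β R q x).sqrt
  have hℓb : ∀ β R q x η, |ℓ β R q x η| ≤ Real.sqrt (|β| * (R : ℝ) ^ 4 / |C| * (2 * rF.N)) := fun β R q x η => by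
    simp only [hℓdef]
    rw [abs_of_nonneg (Real.sqrt_nonneg _)]
    exact Real.sqrt_le_sqrt ((le_abs_self _).trans (abs_carrierCl_le (r := rF) C one_pos β R q x η))
  -- (EM_Q) for `1·ℓ²` from the rescaled (EM_lin), restricted to β ≥ β₀ and R·uRec β ≤ ℓ₀
  have hEMQ1 := emQ_of_subGaussianLinear rF Transport.uRec (β₁ := β₀) (ℓ₁ := ℓ₀) ℓ
    (fun β R => Real.sqrt (|β| * (R : ℝ) ^ 4 / |C| * (2 * rF.N))) hℓm hℓb (m := m₁ / Real.sqrt C) (v := v₁ / C) (lam := 1)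
    zero_le_one (by linarith)
    (fun β hβ L n q x R hq hR hRa hL hsep T t =>
      hEMC β (hβ₀₁'.trans hβ) L n q x R hq hR (hRa.trans (min_le_right _ _)) hL hsep T t)
  -- convert `1·(√Q)²` to `Q` (β ≥ β₀ ≥ 0)
  have hEMQ : ∀ β : ℝ, β₀ ≤ β → ∀ (L n : ℕ) (q : Fin n → Fin 4 × Fin 4) (x : Fin n → (Fin 4 → ℤ)) (R : ℕ),
      (∀ i, (q i).1 < (q i).2) → 1 ≤ R → (R : ℝ) * Transport.uRec β ≤ ℓ₀ → 4 * R + 8 ≤ L →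
      (∀ i j : Fin n, i ≠ j → ∃ k : Fin 4,
        (2 * (R : ℤ) + 4) ≤ |((((x i k - x j k : ℤ) : ZMod (2 * L + 1))).valMinAbs : ℤ)|) →
      ∀ T : Finset (Fin n),
        torusE (Matrix.specialUnitaryGroup (Fin 2) ℂ) rF β L
          (fun U => Real.exp (((2 : ℕ) : ℝ) * ∑ i ∈ T, Q β R (q i) (x i) U)) ≤
          Real.exp (Real.log (2 * (Real.sqrt (1 / (1 - 4 * (1 * (v₁ / C)))) *
            Real.exp (2 * 1 * (m₁ / Real.sqrt C) ^ 2 / (1 - 4 * (1 * (v₁ / C)))))) * T.card) := by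
    intro β hβ L n q x R hq hR hRa hL hsep T
    have h := hEMQ1 β hβ L n q x R hq hR hRa hL hsep T
    have e : (fun U : LGConfig 4 (Matrix.specialUnitaryGroup (Fin 2) ℂ) =>
        Real.exp (((2 : ℕ) : ℝ) * ∑ i ∈ T, Q β R (q i) (x i) U)) =
        (fun U => Real.exp (((2 : ℕ) : ℝ) * ∑ i ∈ T, 1 * (ℓ β R (q i) (x i) U) ^ 2)) := by
      funext U
      refine congrArg Real.exp (congrArg _ (Finset.sum_congr rfl fun i _ => ?_))
      simp only [hQdef, hℓdef]
      rw [one_mul, Real.sq_sqrt (carrierCl_nonneg (r := rF) hCpos one_pos (hβ₀0.trans hβ) R (q i) (x i) U)]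
    rw [e]
    exact h
  -- (RM) body from p541348
  have hRM := responseMoments_of_quadratic_and_influence (N := 2) rF Transport.uRec
    (C₁ := C₁ * C / C_s) (β₁ := β₀) (ℓ₁ := ℓ₀) (A₀ := A₀) (p := p) Q
    (fun β R => |β| * (R : ℝ) ^ 4 / |C| * (2 * rF.N))
    (fun β R q x => measurable_carrierCl (r := rF) C 1 β R q x)
    (fun β R q x η => abs_carrierCl_le (r := rF) C one_pos β R q x η) 𝔟 ε kmax
    (fun β hβ R hR hRa q x hq η => hsplitC β (hβ₀₁.trans hβ) R hR (hRa.trans (min_le_left _ _)) q x hq η)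
    hEMQ
    (fun β hβ L n q x R hq hR hRa hL hsep T =>
      hEMI β (hβ₀₁.trans hβ) L n q x R hq hR (hRa.trans (min_le_left _ _)) hL hsep T)
  refine ⟨Transport.uRec, 1, C₁ * C / C_s, _, β₀, ℓ₀, P₀, p, one_pos,
    Filter.Eventually.of_forall fun β => by rw [one_mul], hℓ₀pos, by positivity, hp, hRM⟩

end Glue

end Summit.QuantumFields.YangMills.Cruxes.UVSeamRec.ClassicalResponse

end
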